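import Summits.KontsevichZagierPeriods.KontsevichZagierPeriods.Theorems.LinRedNormalFormArrangementNormalFormSeparateThreeHIColumn

/-!
# Termwise absolute convergence in the sheared coordinates (cell above the pole plane)

(Line `janus-bands`, crux `ArrangementNormalForm`, stub `stub_separateThreeZero`, part `HICore` of
the termwise numerator split `separateThree_hI` under the rim condition.)

`core_pos` (registered as `separateThree_core`): for a bounded open polyhedral cell `Ω` over the
base plane, above the pole plane when `n ≠ 0`, with the integrand
`Fform = (∑_{i<N} Qᵢ w^i)/Wt · w^{-n}` absolutely integrable on `Ω`, no letter of non-zero exponent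
identically zero, and the RIM CONDITION, every Taylor piece `Qᵢ/Wt · w^i/w^n` is absolutely
integrable on `Ω`. Proof: the column lemma (part `HIColumn`) at every base point of a large closed
ball, compactness of the ball, and Tonelli over each of the finitely many base balls
(`integrableOn_of_fibre_bound`), the base weights `FF`, `‖v − v₀‖⁻¹`, `1` having finite integrals.
-/

noncomputable section

open Set MeasureTheory Filter Topology
open scoped ENNReal

namespace Summit.KontsevichZagierPeriods.ArrangementNormalForm.JanusBands

namespace SepThree

section Core

variable {J m : ℕ} (g : Fin J → Con) (κ : Fin m → Fin 2 → ℝ) (μ : Fin m → ℝ) (e : Fin m → ℕ)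
  (N : ℕ) (q : ℕ → MvPolynomial (Fin 2) ℝ) (n : ℕ)

/-- `FF` is a measurable function of the base point. -/
theorem measurable_FF : Measurable (FF κ μ e N q n (Om3 g)) :=
  measurable_fibre_lintegral (measurableSet_Om3 g) (measurable_Fform κ μ e N q n).enorm

/-- **Integrability on a base ball from the column bound.** -/
theorem integrableOn_ball (hint : IntegrableOn (Fform κ μ e N q n) (Om3 g)) (i : ℕ)
    (v₀ : Fin 2 → ℝ) {δ : ℝ} (hδ1 : δ ≤ 1) {C : ℝ≥0∞} (hC : C ≠ ∞)
    (hb : ∀ v : Fin 2 → ℝ, v ≠ v₀ → ‖v - v₀‖ < δ →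
      FI κ μ e q n (Om3 g) i v ≤ C * (FF κ μ e N q n (Om3 g) v + ENNReal.ofReal ‖v - v₀‖⁻¹ + 1)) :
    IntegrableOn (tpiece κ μ e q n i) (Om3 g ∩ Prod.fst ⁻¹' Metric.ball v₀ δ) := by
  have hS : MeasurableSet (Metric.ball v₀ δ) := measurableSet_ball
  refine integrableOn_of_fibre_bound (measurableSet_Om3 g) hS (measurable_tpiece κ μ e q n i)
    (G := fun v => C * (FF κ μ e N q n (Om3 g) v + ENNReal.ofReal ‖v - v₀‖⁻¹ + 1)) ?_ ?_
  · have hne : ∀ᵐ v ∂(volume : Measure (Fin 2 → ℝ)), v ∉ ({v₀} : Set (Fin 2 → ℝ)) :=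
      (countable_singleton v₀).ae_notMem _
    filter_upwards [ae_restrict_mem hS, ae_restrict_of_ae hne] with v hv hv₀
    rw [Metric.mem_ball, dist_eq_norm] at hv
    exact hb v hv₀ hv
  · have hmF : Measurable fun v : Fin 2 → ℝ => FF κ μ e N q n (Om3 g) v := measurable_FF g κ μ e N q n
    have hmb : Measurable fun v : Fin 2 → ℝ => ENNReal.ofReal ‖v - v₀‖⁻¹ := by fun_prop
    have hm1 : Measurable fun v : Fin 2 → ℝ => FF κ μ e N q n (Om3 g) v + ENNReal.ofReal ‖v - v₀‖⁻¹ :=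
      hmF.add hmb
    have hm2 : Measurable fun v : Fin 2 → ℝ => FF κ μ e N q n (Om3 g) v + ENNReal.ofReal ‖v - v₀‖⁻¹ + 1 :=
      hm1.add measurable_const
    have e1 : ∫⁻ v in Metric.ball v₀ δ, C * (FF κ μ e N q n (Om3 g) v + ENNReal.ofReal ‖v - v₀‖⁻¹ + 1) =
        C * ((∫⁻ v in Metric.ball v₀ δ, FF κ μ e N q n (Om3 g) v) +
          (∫⁻ v in Metric.ball v₀ δ, ENNReal.ofReal ‖v - v₀‖⁻¹) + ∫⁻ _ in Metric.ball v₀ δ, (1 : ℝ≥0∞)) := by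
      rw [lintegral_const_mul _ hm2, lintegral_add_left hm1, lintegral_add_left hmF]
    rw [e1]
    refine ENNReal.mul_lt_top hC.lt_top ?_
    refine ENNReal.add_lt_top.2 ⟨ENNReal.add_lt_top.2 ⟨?_, ?_⟩, ?_⟩
    · exact lintegral_fibre_lt_top (measurableSet_Om3 g) hS (measurable_Fform κ μ e N q n) hint
    · exact lintegral_inv_norm_ball_lt_top v₀ hδ1
    · rw [setLIntegral_const]
      exact ENNReal.mul_lt_top ENNReal.one_lt_top (measure_ball_lt_top)

/-- **Termwise absolute convergence in the sheared coordinates.** See the module docstring. -/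
theorem core_pos (hbd : Bornology.IsBounded (Om3 g))
    (hpos : n ≠ 0 → ∀ p ∈ Om3 g, 0 < p.2) (hint : IntegrableOn (Fform κ μ e N q n) (Om3 g))
    (hnd : ∀ j, e j ≠ 0 → ¬(κ j = 0 ∧ μ j = 0))
    (hRim : ∀ p ∈ closure (Om3 g), (∃ j, e j ≠ 0 ∧ lval κ μ j p.1 = 0) →
      (n ≠ 0 ∧ p.2 = 0) ∨ ∃ p' ∈ closure (Om3 g), p' ≠ p ∧ p'.1 = p.1)
    (i : ℕ) (hi : i < N) : IntegrableOn (tpiece κ μ e q n i) (Om3 g) := by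
  classical
  -- a large radius
  obtain ⟨R₀, hR₀⟩ := hbd.subset_ball 0
  set R := max R₀ 1 with hR
  have hR0 : 0 < R := lt_max_of_lt_right one_pos
  have hΩR : ∀ p ∈ Om3 g, ‖p‖ < R := fun p hp => by
    have := hR₀ hp
    rw [Metric.mem_ball, dist_zero_right] at this
    exact this.trans_le (le_max_left _ _)
  have hRw : ∀ p ∈ Om3 g, |p.2| < R := fun p hp =>
    lt_of_le_of_lt (by rw [← Real.norm_eq_abs]; exact norm_snd_le p) (hΩR p hp)
  -- the column bound at every base point, with radius at most `1`
  have hcol : ∀ v₀ : Fin 2 → ℝ, ∃ δ > 0, δ ≤ 1 ∧ ∃ C : ℝ≥0∞, C ≠ ∞ ∧ ∀ v : Fin 2 → ℝ, v ≠ v₀ →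
      ‖v - v₀‖ < δ → FI κ μ e q n (Om3 g) i v ≤
        C * (FF κ μ e N q n (Om3 g) v + ENNReal.ofReal ‖v - v₀‖⁻¹ + 1) := by
    intro v₀
    obtain ⟨δ, hδ, C, hC, hb⟩ := column g κ μ e N q n i v₀ hbd hR0 hRw hpos hint hnd hRim hi
    exact ⟨min δ 1, lt_min hδ one_pos, min_le_right _ _, C, hC, fun v hv hvδ =>
      hb v hv (hvδ.trans_le (min_le_left _ _))⟩
  choose δ hδ hδ1 C hC hb using hcol
  -- compactness of the base ball
  have hK : IsCompact (Metric.closedBall (0 : Fin 2 → ℝ) R) := isCompact_closedBall 0 R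
  obtain ⟨t, ht⟩ := hK.elim_finite_subcover (fun v₀ : Fin 2 → ℝ => Metric.ball v₀ (δ v₀))
    (fun _ => Metric.isOpen_ball) (fun v₀ _ => mem_iUnion.2 ⟨v₀, Metric.mem_ball_self (hδ v₀)⟩)
  have hcov : Om3 g ⊆ ⋃ v₀ ∈ t, Om3 g ∩ Prod.fst ⁻¹' Metric.ball v₀ (δ v₀) := by
    intro p hp
    have hp1 : p.1 ∈ Metric.closedBall (0 : Fin 2 → ℝ) R := by
      rw [Metric.mem_closedBall, dist_zero_right]
      exact ((norm_fst_le p).trans (hΩR p hp).le)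
    obtain ⟨v₀, hv₀⟩ := mem_iUnion.1 (ht hp1)
    obtain ⟨hv₀t, hball⟩ := mem_iUnion.1 hv₀
    exact mem_iUnion₂.2 ⟨v₀, hv₀t, hp, hball⟩
  refine IntegrableOn.mono_set ?_ hcov
  exact integrableOn_finset_iUnion.2 fun v₀ _ =>
    integrableOn_ball g κ μ e N q n hint i v₀ (hδ1 v₀) (hC v₀) (hb v₀)

end Core

end SepThree

/-- **Termwise absolute convergence in the sheared coordinates** (registered part of
`stub_separateThreeZero`; literal form of `SepThree.core_pos`): for a bounded open polyhedral cell
`Ω ⊆ (Fin 2 → ℝ) × ℝ`, above the pole plane `w = 0` when `n ≠ 0`, with the integrand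
`Fform = (∑_{i<N} Qᵢ(v) w^i)/Wt(v) · w^{-n}` absolutely integrable on `Ω`, no letter of non-zero
exponent identically zero, and the rim condition (a letter of non-zero exponent vanishes at a point
of the closure only on the pole plane with `n ≠ 0` or where the closed vertical fibre is
non-degenerate), every Taylor piece `Qᵢ(v)/Wt(v) · w^i/w^n`, `i < N`, is absolutely integrable on
`Ω`. -/
theorem separateThree_core {J m : ℕ} (g : Fin J → (Fin 2 → ℝ) × ℝ × ℝ) (κ : Fin m → Fin 2 → ℝ) (μ : Fin m → ℝ) (e : Fin m → ℕ) (N : ℕ) (q : ℕ → MvPolynomial (Fin 2) ℝ) (n : ℕ) (hbd : Bornology.IsBounded (SepThree.Om3 g)) (hpos : n ≠ 0 → ∀ p ∈ SepThree.Om3 g, 0 < p.2) (hint : MeasureTheory.IntegrableOn (SepThree.Fform κ μ e N q n) (SepThree.Om3 g)) (hnd : ∀ j, e j ≠ 0 → ¬(κ j = 0 ∧ μ j = 0)) (hRim : ∀ p ∈ closure (SepThree.Om3 g), (∃ j, e j ≠ 0 ∧ SepThree.lval κ μ j p.1 = 0) → (n ≠ 0 ∧ p.2 = 0) ∨ ∃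 p' ∈ closure (SepThree.Om3 g), p' ≠ p ∧ p'.1 = p.1) (i : ℕ) (hi : i < N) : MeasureTheory.IntegrableOn (SepThree.tpiece κ μ e q n i) (SepThree.Om3 g) := by
  exact SepThree.core_pos g κ μ e N q n hbd hpos hint hnd hRim i hi

end Summit.KontsevichZagierPeriods.ArrangementNormalForm.JanusBands
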